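import Literature.NumberTheory.EllipticCurves.Sprung2012.ColemanMapJointInjectiveProofs
import Literature.NumberTheory.EllipticCurves.Sprung2012.ColemanPairExistsProofs
import Literature.NumberTheory.EllipticCurves.Sprung2012.ColemanMapLambdaActionProofs
import Literature.NumberTheory.EllipticCurves.Sprung2012.LocalIwasawaModule
import Mathlib.Algebra.Polynomial.Degree.Domain
import HarnessLib

/-!
# Route `ByReductionTypeAtTwo` (rung K4), crux `SupersingularRankZeroAtTwo` (item stmt-BirchSwinnertonDyer-19097), line
# `odd_blind_package`, slot 5 `stub_CD` = CDC_H, hand h9 = HT-C7locE = (hE), conjunct (C) (the LINE BOUND): **READING THE VALUE OF A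
# FUNCTIONAL AT A `ℤ[γ]`-COMBINATION OF HONDA POINTS OFF SPRUNG'S COLEMAN CONGRUENCES** — points `r(g⁻¹ − 1)·y` of the local tower,
# their pairing polynomials `P_{n, r(g⁻¹−1)y}(z) = P_{n,y}(r(Θ_g − 1) z)`, the reading `z(y) ≡ F₀(−1) (mod p^s)` from
# `P_{n,y}(z) ≡ F₀ + p^s G (mod ω_n)`, and the level-`n` congruence of the point `x = α(g⁻¹−1) c_n + β(g⁻¹−1) c_{n−1}`:
# `ω_n ∣ P_{n,x}(z) + L♯·(α u_n + β φ_n u_{n−1}) + L♭·(α v_n + β φ_n v_{n−1})`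
# (cell `bsd-2adic`, seat `bsd-2adic-tower-1` GEN 62; any `K`, any completion, any `p`)

HONEST FRAMING: THEOREMS ONLY (no definition, no named fact, no instance, no `sorry`); plumbing on the tree's transcription of Sprung 2012
(`Sprung2012/ColemanMaps.lean`: `pairingSum`, `IsColemanPair`; `LocalIwasawaModule.lean`: `twistEnd`; `ColemanPairExistsProofs.lean`:
`thetaPoly`; `ColemanMapLambdaActionProofs.lean`: `IsColemanPair.aeval_twistEnd`); a helper `--supports 19097`; nothing about any curve is
asserted; BSD is proved for no curve by any of this. bears_on: K4 (19097).

## What is proved (for a `ℤ`-linear `σ` on `E(K̄_E)` with `σ P = g⁻¹ • P`, written as a hypothesis `hσ`)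

* §1 `smul_aeval_comm`, `aeval_mem_of_forall_smul_mem` — `h' • r(σ−1)P = r(σ−1)(h' • P)` for `h'` commuting with `g⁻¹`; stability;
  ★ `aeval_twistEnd_map_apply` — NATURALITY: `(r(Θ_g − 1) z)(y) = z(r(σ − 1) y)` (`Θ_g z = z ∘ g⁻¹`, `r ∈ ℤ[T]`).
* §2 `thetaPoly_aeval_point` — `Θ_n(r(σ−1)y, z) = Θ_n(y, r(Θ_g−1)z)`; `pairingSum_inv_smul` — `P_n(g⁻¹y, z) ≡ (1+T)P_n(y, z) (mod ω_n)`
  (`pairingSum_twist`); `natDegree_thetaPoly_lt`, `eval_neg_one_thetaPoly` (`Θ_n(y,z)(−1) = z(y)`).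
* §3 ★ `pow_dvd_apply_sub_eval_of_omega_dvd` — THE READING LEMMA: if `ω_n ∣ P_{n,y}(w) − (F₀ + p^s G)` in `Λ` with `deg F₀ < pⁿ`, then
  `p^s ∣ w(y) − F₀(−1)` (Weierstrass division by the distinguished `ω_n`, tree `omega_dvd_of_coe_dvd`, and `Θ_n(y,w)(−1) = w(y)`).
* §4 ★ `omega_dvd_pairingSum_linePoint_add` — for a Coleman pair `(L♯, L♭)` of `z` and `x = α(σ−1) c_{m+1} + β(σ−1) c_m`:
  `ω_{m+1} ∣ P_{m+1,x}(z) + L♯·(α u_{m+1} + β φ_{m+1} u_m) + L♭·(α v_{m+1} + β φ_{m+1} v_m)` (`Λ`-linearity of `Col`, Def. 5.9, at levels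
  `m+1` and `m`, the latter raised by `P_{m+1,c_m} = φ_{m+1} P_{m,c_m}`).

References: [Sprung2012] F. Sprung, J. Number Theory 132 (2012), Def. 3.1 (p. 1489), Prop. 5.5 (p. 1494), Def. 5.9 (p. 1495);
[Washington1997] L. Washington, *Introduction to Cyclotomic Fields*, Prop. 7.2 (Weierstrass division); [Pollack2003] Thm. 6.17 (`ω_n`).
-/

set_option autoImplicit false
set_option linter.dupNamespace false

noncomputable section

open scoped Classical

open Polynomial Finset

universe u

namespace Summit.BirchSwinnertonDyer.BirchSwinnertonDyer.Theorems

namespace OddBlindLocal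

open Literature.NumberTheory.EllipticCurves Literature.NumberTheory.GaloisRepresentations ZpExtension
  Literature.NumberTheory.EllipticCurves.Kobayashi2003 Literature.NumberTheory.EllipticCurves.Sprung2017
  Literature.NumberTheory.EllipticCurves.Sprung2012

section Generic

variable {K : Type u} [Field K] {p : ℕ} [hp : Fact p.Prime] (κ : ZpExtension K p)
variable {E : Type u} [Field E] [Algebra K E] (ι : AlgebraicClosure K →ₐ[K] AlgebraicClosure E)
variable (W : WeierstrassCurve K)

/-! ## §1 Points `r(σ − 1)·P` and the naturality `(r(Θ_g − 1) z)(y) = z(r(σ − 1) y)` -/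

omit hp in
/-- `h' • r(σ−1)P = r(σ−1)(h' • P)` when `σ = (h • ·)` and `h'` commutes with `h`. [cite: Sprung2012, Def. 3.1 (p. 1489) (the G_n-action)] -/
theorem smul_aeval_comm {σ : Module.End ℤ (localPoints W E)} {h h' : Field.absoluteGaloisGroup E}
    (hσ : ∀ P, σ P = h • P) (hc : Commute h' h) (r : ℤ[X]) (P : localPoints W E) :
    h' • aeval (σ - 1) r P = aeval (σ - 1) r (h' • P) := by
  induction r using Polynomial.induction_on generalizing P with
  | C a =>
    rw [aeval_C, Module.algebraMap_end_apply, Module.algebraMap_end_apply]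
    exact map_zsmul (DistribSMul.toAddMonoidHom (localPoints W E) h') a P
  | add r s hr hs => rw [map_add, LinearMap.add_apply, LinearMap.add_apply, smul_add, hr, hs]
  | monomial k a ih =>
    have e : C a * X ^ (k + 1) = X * (C a * X ^ k) := by ring
    rw [e, map_mul, Module.End.mul_apply, Module.End.mul_apply, aeval_X, LinearMap.sub_apply, LinearMap.sub_apply,
      Module.End.one_apply, Module.End.one_apply, hσ, hσ, smul_sub, ← ih, smul_smul, smul_smul, hc.eq]

omit hp in
/-- A subgroup stable under `h` is stable under `r(σ − 1)`, `σ = (h • ·)`. [cite: Sprung2012, Def. 3.1 (p. 1489) (the G_n-action)] -/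
theorem aeval_mem_of_forall_smul_mem {σ : Module.End ℤ (localPoints W E)} {h : Field.absoluteGaloisGroup E}
    (hσ : ∀ P, σ P = h • P) (A : AddSubgroup (localPoints W E)) (hA : ∀ P ∈ A, h • P ∈ A) (r : ℤ[X]) {P : localPoints W E}
    (hP : P ∈ A) : aeval (σ - 1) r P ∈ A := by
  induction r using Polynomial.induction_on generalizing P with
  | C a => rw [aeval_C, Module.algebraMap_end_apply]; exact A.zsmul_mem hP a
  | add r s hr hs => rw [map_add, LinearMap.add_apply]; exact add_mem (hr hP) (hs hP)
  | monomial k a ih =>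
    have e : C a * X ^ (k + 1) = X * (C a * X ^ k) := by ring
    rw [e, map_mul, Module.End.mul_apply, aeval_X, LinearMap.sub_apply, Module.End.one_apply, hσ]
    exact sub_mem (hA _ (ih hP)) (ih hP)

/-- ★ **Naturality**: for `r ∈ ℤ[T]`, a functional `z` on `E(K_∞·K_v)` and a tower point `y`,
`(r(Θ_g − 1) z)(y) = z(r(σ − 1) y)` — the action `γ ↦ 1 + T` on `H¹_Iw(T)` (`Θ_g z = z ∘ g⁻¹`, Sprung §2 p. 1486) read on points
(`σ = (g⁻¹ • ·)`). [cite: Sprung2012, §2 p. 1486 and Def. 3.1 (p. 1489)] -/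
theorem aeval_twistEnd_map_apply (g : Field.absoluteGaloisGroup E) {σ : Module.End ℤ (localPoints W E)}
    (hσ : ∀ P, σ P = g⁻¹ • P) (r : ℤ[X]) (z : localTowerPointsOfEmb κ ι W →+ ℤ_[p]) :
    ∀ (y : localPoints W E) (hy : y ∈ localTowerPointsOfEmb κ ι W)
      (hy' : aeval (σ - 1) r y ∈ localTowerPointsOfEmb κ ι W),
      (aeval (twistEnd κ ι W g - 1) (r.map (Int.castRingHom ℤ_[p])) z) ⟨y, hy⟩ = z ⟨aeval (σ - 1) r y, hy'⟩ := by
  induction r using Polynomial.induction_on with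
  | C a =>
    intro y hy hy'
    rw [Polynomial.map_C, aeval_C, Module.algebraMap_end_apply, AddMonoidHom.smul_apply]
    have e : (⟨aeval (σ - 1) (C a) y, hy'⟩ : localTowerPointsOfEmb κ ι W) = a • ⟨y, hy⟩ := by
      apply Subtype.ext
      rw [AddSubgroupClass.coe_zsmul]
      change aeval (σ - 1) (C a) y = a • y
      rw [aeval_C, Module.algebraMap_end_apply]
    rw [e, map_zsmul, zsmul_eq_mul, smul_eq_mul, eq_intCast]
  | add r s hr hs =>
    intro y hy hy'
    have hr' : aeval (σ - 1) r y ∈ localTowerPointsOfEmb κ ι W :=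
      aeval_mem_of_forall_smul_mem W hσ _ (fun P hP ↦ smul_mem_localTowerPointsOfEmb κ ι W g⁻¹ hP) r hy
    have hs' : aeval (σ - 1) s y ∈ localTowerPointsOfEmb κ ι W :=
      aeval_mem_of_forall_smul_mem W hσ _ (fun P hP ↦ smul_mem_localTowerPointsOfEmb κ ι W g⁻¹ hP) s hy
    have e : (⟨aeval (σ - 1) (r + s) y, hy'⟩ : localTowerPointsOfEmb κ ι W) = ⟨_, hr'⟩ + ⟨_, hs'⟩ := by
      apply Subtype.ext
      rw [AddSubgroup.coe_add]
      change aeval (σ - 1) (r + s) y = aeval (σ - 1) r y + aeval (σ - 1) s y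
      rw [map_add, LinearMap.add_apply]
    rw [Polynomial.map_add, map_add, LinearMap.add_apply, AddMonoidHom.add_apply, hr y hy hr', hs y hy hs', e, map_add]
  | monomial k a ih =>
    intro y hy hy'
    have e : C a * X ^ (k + 1) = X * (C a * X ^ k) := by ring
    have hgy : g⁻¹ • y ∈ localTowerPointsOfEmb κ ι W := smul_mem_localTowerPointsOfEmb κ ι W g⁻¹ hy
    have hq : ∀ {P : localPoints W E}, P ∈ localTowerPointsOfEmb κ ι W →
        aeval (σ - 1) (C a * X ^ k) P ∈ localTowerPointsOfEmb κ ι W := fun hP ↦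
      aeval_mem_of_forall_smul_mem W hσ _ (fun P hP ↦ smul_mem_localTowerPointsOfEmb κ ι W g⁻¹ hP) _ hP
    have e2 : (⟨aeval (σ - 1) (C a * X ^ (k + 1)) y, hy'⟩ : localTowerPointsOfEmb κ ι W) =
        ⟨_, hq hgy⟩ - ⟨_, hq hy⟩ := by
      apply Subtype.ext
      rw [AddSubgroupClass.coe_sub]
      change aeval (σ - 1) (C a * X ^ (k + 1)) y = aeval (σ - 1) (C a * X ^ k) (g⁻¹ • y) - aeval (σ - 1) (C a * X ^ k) y
      rw [e, map_mul, Module.End.mul_apply, aeval_X, LinearMap.sub_apply, Module.End.one_apply, hσ,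
        smul_aeval_comm W hσ (Commute.refl g⁻¹)]
    rw [e2, map_sub, e, Polynomial.map_mul, Polynomial.map_X, map_mul, Module.End.mul_apply, aeval_X, LinearMap.sub_apply,
      Module.End.one_apply, AddMonoidHom.sub_apply, twistEnd_apply, ih _ hgy (hq hgy), ih y hy (hq hy)]

/-! ## §2 Pairing polynomials of `r(σ − 1)·y` and of `g⁻¹ • y`; degree and value at `T = −1` -/

/-- **`Θ_n(r(σ−1) y, z) = Θ_n(y, r(Θ_g − 1) z)`**: the pairing polynomial of the point `r(σ−1) y` against `z` is that of `y` against
`r(Θ_g−1) z` (`gʲ` commutes with `r(σ − 1)`; naturality). [cite: Sprung2012, Def. 3.1 (p. 1489)] -/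
theorem thetaPoly_aeval_point (g : Field.absoluteGaloisGroup E) {σ : Module.End ℤ (localPoints W E)}
    (hσ : ∀ P, σ P = g⁻¹ • P) (r : ℤ[X]) (z : localTowerPointsOfEmb κ ι W →+ ℤ_[p]) {y : localPoints W E}
    (hy : y ∈ localTowerPointsOfEmb κ ι W) (n : ℕ) :
    thetaPoly κ ι W g n (aeval (σ - 1) r y) z =
      thetaPoly κ ι W g n y (aeval (twistEnd κ ι W g - 1) (r.map (Int.castRingHom ℤ_[p])) z) := by
  rw [thetaPoly, thetaPoly]
  refine Finset.sum_congr rfl fun j _ ↦ ?_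
  have hgy : g ^ j • y ∈ localTowerPointsOfEmb κ ι W := smul_mem_localTowerPointsOfEmb κ ι W _ hy
  have hmem : aeval (σ - 1) r (g ^ j • y) ∈ localTowerPointsOfEmb κ ι W :=
    aeval_mem_of_forall_smul_mem W hσ _ (fun P hP ↦ smul_mem_localTowerPointsOfEmb κ ι W g⁻¹ hP) r hgy
  have hcomm : Commute (g ^ j) g⁻¹ := (Commute.refl g).inv_right.pow_left j
  rw [smul_aeval_comm W hσ hcomm r y, evalOn_of_mem W _ _ hmem, evalOn_of_mem W _ _ hgy,
    aeval_twistEnd_map_apply κ ι W g hσ r z _ hgy hmem]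

/-- **`Θ_n(g⁻¹y, z) = (1+T)·Θ_n(y, z) − z(g⁻¹y)·ω_n`** for `y` of level `n` — the tree's `pairingSum_twist` read on the point side
(`Θ_n(g⁻¹ y, z) = Θ_n(y, z ∘ g⁻¹)`). [cite: Sprung2012, Def. 3.1 (p. 1489) and §2 p. 1486] -/
theorem pairingSum_inv_smul {g : Field.absoluteGaloisGroup E} (hg : κ.IsTopGenerator (resGalOfEmb ι g)) {n : ℕ}
    {y : localPoints W E} (hy : y ∈ localLayerPointsOfEmb κ ι W n) (z : localTowerPointsOfEmb κ ι W →+ ℤ_[p]) :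
    pairingSum W (localTowerPointsOfEmb κ ι W) g n (g⁻¹ • y) z =
      (1 + PowerSeries.X) * pairingSum W (localTowerPointsOfEmb κ ι W) g n y z -
        PowerSeries.C (z ⟨g⁻¹ • y, smul_mem_localTowerPointsOfEmb κ ι W g⁻¹
          (localLayerPointsOfEmb_le_localTowerPointsOfEmb κ ι W n hy)⟩) * toIwasawa p (cyclotomicOmega p n) := by
  rw [← pairingSum_twist κ ι W hg hy z (twistEnd κ ι W g z) (twistEnd_apply κ ι W g z), pairingSum_def, pairingSum_def]
  refine Finset.sum_congr rfl fun j _ ↦ ?_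
  have hyT := localLayerPointsOfEmb_le_localTowerPointsOfEmb κ ι W n hy
  have h1 : g ^ j • g⁻¹ • y ∈ localTowerPointsOfEmb κ ι W :=
    smul_mem_localTowerPointsOfEmb κ ι W _ (smul_mem_localTowerPointsOfEmb κ ι W _ hyT)
  have h2 : g ^ j • y ∈ localTowerPointsOfEmb κ ι W := smul_mem_localTowerPointsOfEmb κ ι W _ hyT
  rw [evalOn_of_mem W _ _ h1, evalOn_of_mem W _ _ h2, twistEnd_apply]
  have e : (⟨g ^ j • g⁻¹ • y, h1⟩ : localTowerPointsOfEmb κ ι W) =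
      ⟨g⁻¹ • ((⟨g ^ j • y, h2⟩ : localTowerPointsOfEmb κ ι W) : localPoints W E),
        smul_mem_localTowerPointsOfEmb κ ι W g⁻¹ h2⟩ := by
    apply Subtype.ext
    change g ^ j • g⁻¹ • y = g⁻¹ • g ^ j • y
    rw [smul_smul, smul_smul, ((Commute.refl g).inv_right.pow_left j).eq]
  rw [e]

/-- `deg Θ_n(y, z) < pⁿ` (a combination of `(1+T)ʲ`, `j < pⁿ`). [cite: Sprung2012, Def. 3.1 (p. 1489)] -/
theorem natDegree_thetaPoly_lt (g : Field.absoluteGaloisGroup E) (n : ℕ) (y : localPoints W E)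
    (z : localTowerPointsOfEmb κ ι W →+ ℤ_[p]) : (thetaPoly κ ι W g n y z).natDegree < p ^ n := by
  have hpos : 0 < p ^ n := pow_pos hp.out.pos n
  rw [thetaPoly]
  refine lt_of_le_of_lt (natDegree_sum_le_of_forall_le _ _ (n := p ^ n - 1) fun j hj ↦ ?_) (by omega)
  refine (natDegree_C_mul_le _ _).trans ?_
  have h1 : (1 + X : ℤ_[p][X]).natDegree ≤ 1 := by rw [add_comm, ← C_1]; exact (natDegree_X_add_C 1).le
  calc ((1 + X : ℤ_[p][X]) ^ j).natDegree ≤ j * 1 := natDegree_pow_le_of_le j h1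
    _ ≤ p ^ n - 1 := by have := Finset.mem_range.mp hj; omega

/-- **`Θ_n(y, z)(−1) = z(y)`**: at `T = −1` only the `j = 0` term of `∑ z(gʲy)(1+T)ʲ` survives. [cite: Sprung2012, Def. 3.1 (p. 1489)] -/
theorem eval_neg_one_thetaPoly (g : Field.absoluteGaloisGroup E) (n : ℕ) {y : localPoints W E}
    (hy : y ∈ localTowerPointsOfEmb κ ι W) (z : localTowerPointsOfEmb κ ι W →+ ℤ_[p]) :
    (thetaPoly κ ι W g n y z).eval (-1) = z ⟨y, hy⟩ := by
  have hpos : 0 < p ^ n := pow_pos hp.out.pos n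
  obtain ⟨N, hN⟩ : ∃ N, p ^ n = N + 1 := ⟨p ^ n - 1, by omega⟩
  rw [thetaPoly, eval_finsetSum, hN, Finset.sum_range_succ', Finset.sum_eq_zero fun j _ ↦ ?_, zero_add, pow_zero, one_smul,
    eval_mul, eval_C, eval_pow, eval_add, eval_one, eval_X, pow_zero, mul_one, evalOn_of_mem W _ _ hy]
  rw [eval_mul, eval_pow, eval_add, eval_one, eval_X, show (1 : ℤ_[p]) + -1 = 0 by ring, zero_pow (Nat.succ_ne_zero j),
    mul_zero]

/-! ## §3 The reading lemma -/

/-- ★ **THE READING LEMMA.**  If `ω_n ∣ P_{n,y}(w) − (F₀ + p^s·G)` in `Λ = ℤ_p⟦T⟧` with `F₀ ∈ ℤ_p[T]` of degree `< pⁿ`, then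
`p^s ∣ w(y) − F₀(−1)`.  Proof: replace `G` by its Weierstrass remainder `r'` modulo `ω_n` (degree `< pⁿ`, Washington Prop. 7.2, tree
`exists_polynomial_toIwasawa_cyclotomicOmega_dvd_sub` + `modByMonic`); then `Θ_n(y, w) − (F₀ + p^s r')` is a polynomial of degree `< pⁿ`
divisible by the monic `ω_n` of degree `pⁿ` (`omega_dvd_of_coe_dvd`), hence `0`; evaluate at `T = −1`.
[cite: Washington1997, Prop. 7.2] [cite: Sprung2012, Def. 3.1 (p. 1489) and Def. 5.9 (p. 1495)] -/
theorem pow_dvd_apply_sub_eval_of_omega_dvd (g : Field.absoluteGaloisGroup E) {n : ℕ} {y : localPoints W E}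
    (hy : y ∈ localTowerPointsOfEmb κ ι W) (w : localTowerPointsOfEmb κ ι W →+ ℤ_[p]) {F₀ : ℤ_[p][X]}
    (hF₀ : F₀.natDegree < p ^ n) (G : IwasawaAlgebra p) (s : ℕ)
    (h : toIwasawa p (cyclotomicOmega p n) ∣
      pairingSum W (localTowerPointsOfEmb κ ι W) g n y w - ((F₀ : PowerSeries ℤ_[p]) + PowerSeries.C ((p : ℤ_[p]) ^ s) * G)) :
    (p : ℤ_[p]) ^ s ∣ w ⟨y, hy⟩ - F₀.eval (-1) := by
  have hpn : 0 < p ^ n := pow_pos hp.out.pos n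
  set Ω : ℤ_[p][X] := (X + 1 : ℤ_[p][X]) ^ p ^ n - 1 with hΩ
  have hω : toIwasawa p (cyclotomicOmega p n) = (Ω : PowerSeries ℤ_[p]) := toIwasawa_cyclotomicOmega_eq_coe p n
  have hmon1 : (X + 1 : ℤ_[p][X]).Monic := by rw [← C_1]; exact monic_X_add_C 1
  have hX1 : (X + 1 : ℤ_[p][X]).natDegree = 1 := by rw [← C_1]; exact natDegree_X_add_C 1
  have hpow : ((X + 1 : ℤ_[p][X]) ^ p ^ n).natDegree = p ^ n := by rw [natDegree_pow, hX1, mul_one]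
  have hΩdeg : Ω.natDegree = p ^ n := by
    rw [hΩ, natDegree_sub_eq_left_of_natDegree_lt, hpow]
    rw [hpow, natDegree_one]; exact hpn
  have hΩmon : Ω.Monic := by
    refine (hmon1.pow (p ^ n)).sub_of_left ?_
    rw [degree_one, degree_eq_natDegree (hmon1.pow (p ^ n)).ne_zero, hpow]
    exact_mod_cast hpn
  have hΩ1 : Ω ≠ 1 := by
    intro h1; have := congrArg natDegree h1; rw [hΩdeg, natDegree_one] at this; omega
  -- polynomial representative of `G` of degree `< pⁿ`
  obtain ⟨r, hr⟩ := exists_polynomial_toIwasawa_cyclotomicOmega_dvd_sub p n G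
  set r' : ℤ_[p][X] := r %ₘ Ω with hr'
  have hrr' : (Ω : PowerSeries ℤ_[p]) ∣ (r : PowerSeries ℤ_[p]) - (r' : PowerSeries ℤ_[p]) := by
    refine ⟨((r /ₘ Ω : ℤ_[p][X]) : PowerSeries ℤ_[p]), ?_⟩
    rw [← Polynomial.coe_mul, ← Polynomial.coe_sub]
    congr 1
    have := modByMonic_add_div r Ω
    rw [hr']
    linear_combination (-1 : ℤ_[p][X]) * this
  have hr'deg : r'.natDegree < p ^ n := by rw [← hΩdeg]; exact natDegree_modByMonic_lt r hΩmon hΩ1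
  -- `Ω ∣ Θ_n(y,w) − (F₀ + p^s r')` in `ℤ_p[X]`
  set θ := thetaPoly κ ι W g n y w with hθ
  have hdvd : (Ω : PowerSeries ℤ_[p]) ∣ ((θ - (F₀ + C ((p : ℤ_[p]) ^ s) * r') : ℤ_[p][X]) : PowerSeries ℤ_[p]) := by
    have e : ((θ - (F₀ + C ((p : ℤ_[p]) ^ s) * r') : ℤ_[p][X]) : PowerSeries ℤ_[p]) =
        (pairingSum W (localTowerPointsOfEmb κ ι W) g n y w - ((F₀ : PowerSeries ℤ_[p]) + PowerSeries.C ((p : ℤ_[p]) ^ s) * G)) +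
          PowerSeries.C ((p : ℤ_[p]) ^ s) * ((G - (r : PowerSeries ℤ_[p])) + ((r : PowerSeries ℤ_[p]) - (r' : PowerSeries ℤ_[p]))) := by
      rw [Polynomial.coe_sub, Polynomial.coe_add, Polynomial.coe_mul, Polynomial.coe_C, hθ, coe_thetaPoly]
      ring
    rw [e]
    rw [hω] at h hr
    exact dvd_add h (dvd_mul_of_dvd_right (dvd_add hr hrr') _)
  have hdvd' : Ω ∣ θ - (F₀ + C ((p : ℤ_[p]) ^ s) * r') := omega_dvd_of_coe_dvd hdvd
  have hdeg : (θ - (F₀ + C ((p : ℤ_[p]) ^ s) * r')).natDegree < Ω.natDegree := by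
    rw [hΩdeg]
    refine lt_of_le_of_lt (natDegree_sub_le _ _) (max_lt (natDegree_thetaPoly_lt κ ι W g n y w) ?_)
    refine lt_of_le_of_lt (natDegree_add_le _ _) (max_lt hF₀ ?_)
    exact lt_of_le_of_lt (natDegree_C_mul_le _ _) hr'deg
  have hzero : θ - (F₀ + C ((p : ℤ_[p]) ^ s) * r') = 0 := eq_zero_of_dvd_of_natDegree_lt hdvd' hdeg
  -- evaluate at `T = −1`
  have heq : θ = F₀ + C ((p : ℤ_[p]) ^ s) * r' := sub_eq_zero.mp hzero
  have hval : w ⟨y, hy⟩ = F₀.eval (-1) + (p : ℤ_[p]) ^ s * r'.eval (-1) := by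
    rw [← eval_neg_one_thetaPoly κ ι W g n hy w, ← hθ, heq, eval_add, eval_mul, eval_C]
  exact ⟨r'.eval (-1), by rw [hval]; ring⟩

/-! ## §4 The level-`m+1` congruence of `x = α(σ−1) c_{m+1} + β(σ−1) c_m` -/

/-- ★ **`ω_{m+1} ∣ P_{m+1,x}(z) + L♯·(α u_{m+1} + β φ_{m+1} u_m) + L♭·(α v_{m+1} + β φ_{m+1} v_m)`** for the point
`x = α(g⁻¹−1)·c_{m+1} + β(g⁻¹−1)·c_m` (`α, β ∈ ℤ[T]`) and any functional `z` with Coleman value `(L♯, L♭)`: `Λ`-linearity of `Col`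
(`IsColemanPair.aeval_twistEnd`: `Col(r(Θ−1)z) = r·Col(z)`) at levels `m+1` and `m`, the level-`m` congruence raised by
`φ_{m+1} = Φ_{p^{m+1}}(1+T)` (`P_{m+1,c_m} = φ_{m+1} P_{m,c_m}`, `ω_{m+1} = ω_m φ_{m+1}`), and `P_{m+1,x}(z) = P_{m+1,c_{m+1}}(α(Θ−1)z) +
P_{m+1,c_m}(β(Θ−1)z)` (§2). [cite: Sprung2012, Def. 5.9 (p. 1495), Prop. 5.5 (p. 1494), Def. 3.1 (p. 1489)] -/
theorem omega_dvd_pairingSum_linePoint_add {ap : ℤ} {g : Field.absoluteGaloisGroup E}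
    (hg : κ.IsTopGenerator (resGalOfEmb ι g)) {c : ℕ → localPoints W E} (hc : ∀ n, c n ∈ localLayerPointsOfEmb κ ι W n)
    {σ : Module.End ℤ (localPoints W E)} (hσ : ∀ P, σ P = g⁻¹ • P) (m : ℕ) (α β : ℤ[X])
    {z : localTowerPointsOfEmb κ ι W →+ ℤ_[p]} {Ls Lf : IwasawaAlgebra p} (hz : IsColemanPair κ ι W ap g c z Ls Lf) :
    toIwasawa p (cyclotomicOmega p (m + 1)) ∣
      pairingSum W (localTowerPointsOfEmb κ ι W) g (m + 1) (aeval (σ - 1) α (c (m + 1)) + aeval (σ - 1) β (c m)) z +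
        (Ls * toIwasawa p (α * sharpPoly ap p (m + 1) + β * ((cyclotomic (p ^ (m + 1)) ℤ).comp (X + 1) * sharpPoly ap p m)) +
          Lf * toIwasawa p (α * flatPoly ap p (m + 1) + β * ((cyclotomic (p ^ (m + 1)) ℤ).comp (X + 1) * flatPoly ap p m))) := by
  have hle := fun n ↦ localLayerPointsOfEmb_le_localTowerPointsOfEmb κ ι W n
  have hstab : ∀ P ∈ localTowerPointsOfEmb κ ι W, g⁻¹ • P ∈ localTowerPointsOfEmb κ ι W :=
    fun P hP ↦ smul_mem_localTowerPointsOfEmb κ ι W g⁻¹ hP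
  -- the two twisted functionals and their Coleman values
  have hα := hz.aeval_twistEnd hg hc (twistEnd_apply κ ι W g) (α.map (Int.castRingHom ℤ_[p]))
  have hβ := hz.aeval_twistEnd hg hc (twistEnd_apply κ ι W g) (β.map (Int.castRingHom ℤ_[p]))
  have h1 := hα (m + 1)
  have h2 := hβ m
  -- `P_{m+1,x}(z)` as a sum
  have hxα : aeval (σ - 1) α (c (m + 1)) ∈ localTowerPointsOfEmb κ ι W :=
    aeval_mem_of_forall_smul_mem W hσ _ hstab α (hle _ (hc (m + 1)))
  have hxβ : aeval (σ - 1) β (c m) ∈ localTowerPointsOfEmb κ ι W := aeval_mem_of_forall_smul_mem W hσ _ hstab β (hle _ (hc m))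
  have hP : pairingSum W (localTowerPointsOfEmb κ ι W) g (m + 1) (aeval (σ - 1) α (c (m + 1)) + aeval (σ - 1) β (c m)) z =
      pairingSum W (localTowerPointsOfEmb κ ι W) g (m + 1) (c (m + 1))
          (aeval (twistEnd κ ι W g - 1) (α.map (Int.castRingHom ℤ_[p])) z) +
        toIwasawa p ((cyclotomic (p ^ (m + 1)) ℤ).comp (X + 1)) *
          pairingSum W (localTowerPointsOfEmb κ ι W) g m (c m) (aeval (twistEnd κ ι W g - 1) (β.map (Int.castRingHom ℤ_[p])) z) := by
    rw [← coe_thetaPoly, ← coe_thetaPoly, ← coe_thetaPoly, thetaPoly_add κ ι W g (m + 1) hxα hxβ,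
      thetaPoly_aeval_point κ ι W g hσ α z (hle _ (hc (m + 1))), thetaPoly_aeval_point κ ι W g hσ β z (hle _ (hc m)),
      thetaPoly_succ_of_mem_layer κ ι W hg (hc m), Polynomial.coe_add, Polynomial.coe_mul]
    rfl
  -- `ω_{m+1} = ω_m · φ_{m+1}`
  have hω : toIwasawa p (cyclotomicOmega p (m + 1)) =
      toIwasawa p (cyclotomicOmega p m) * toIwasawa p ((cyclotomic (p ^ (m + 1)) ℤ).comp (X + 1)) := by
    rw [cyclotomicOmega_succ, map_mul]
  have h2' : toIwasawa p (cyclotomicOmega p (m + 1)) ∣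
      toIwasawa p ((cyclotomic (p ^ (m + 1)) ℤ).comp (X + 1)) *
        (pairingSum W (localTowerPointsOfEmb κ ι W) g m (c m) (aeval (twistEnd κ ι W g - 1) (β.map (Int.castRingHom ℤ_[p])) z) +
          (toIwasawa p (sharpPoly ap p m) * (((β.map (Int.castRingHom ℤ_[p]) : ℤ_[p][X]) : PowerSeries ℤ_[p]) * Ls) +
            toIwasawa p (flatPoly ap p m) * (((β.map (Int.castRingHom ℤ_[p]) : ℤ_[p][X]) : PowerSeries ℤ_[p]) * Lf))) := by
    rw [hω, mul_comm (toIwasawa p (cyclotomicOmega p m))]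
    exact mul_dvd_mul_left _ h2
  have hsum := dvd_add h1 h2'
  rw [hP]
  convert hsum using 1
  simp only [map_add, map_mul]
  change _ = _ + (toIwasawa p (sharpPoly ap p (m + 1)) * (toIwasawa p α * Ls) + toIwasawa p (flatPoly ap p (m + 1)) * (toIwasawa p α * Lf)) +
    toIwasawa p ((cyclotomic (p ^ (m + 1)) ℤ).comp (X + 1)) * (_ + (toIwasawa p (sharpPoly ap p m) * (toIwasawa p β * Ls) +
      toIwasawa p (flatPoly ap p m) * (toIwasawa p β * Lf)))
  ring

end Generic

end OddBlindLocal

end Summit.BirchSwinnertonDyer.BirchSwinnertonDyer.Theorems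

end
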